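import Summits.CriticalPhenomena.Ising3DConformalLimit.Theorems.AnomalousForcesInteractionEtaPositiveOfThermalRates
import Summits.CriticalPhenomena.Ising3DConformalLimit.Theorems.AnomalousForcesInteractionEtaPositiveWindow
import HarnessLib

/-!
# Crux `EtaPositive` (stmt-CriticalPhenomena-2600): the window of the thermal-rates certificate

Route `AnomalousForcesInteraction` (Ising3DConformalLimit), line `registered`. The pre-paid closing
`EtaPositive_of_thermalRates` (p154822) takes two rates on the low-temperature side of `β_c(3)` —
`m*(β_c+t) ≤ C₁ t^{b̂}` and a truncated plus-susceptibility bound `χ⁺_trunc(β_c+t) ≤ C₂ t^{-g}` on `(0, t₀]` —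
with `g < 4b̂`, through the isotherm rate `b̂/(b̂+g)` (`isotherm_of_thermalRates`). This file records the
admissible window of that certificate, an UNCONDITIONAL exponent inequality for the nearest-neighbour Ising
model on `ℤ³`:

* `thermalRates_window` — any such pair of rates has `2b̂ ≤ g` ("`γ' ≥ 2β`" in bound form: Griffiths'
  `γ' ≥ β(δ-1)` combined with `δ ≥ 3`, here obtained as `b̂/(b̂+g) ≤ 1/3` from the unconditional isotherm
  window `isothermGain_exponent_le_third`, p165507, i.e. from the Duminil-Copin–Panis two-point floor). So the
  thermal certificate lives in the window `2b̂ ≤ g < 4b̂` (true values `γ ≈ 1.237`, `β ≈ 0.3265`: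
  `0.653 ≤ 1.237 < 1.306`).

No named fact is assumed; standard axioms.
-/

noncomputable section

namespace Summit.CriticalPhenomena.Ising3DConformalLimit.AnomalousForcesInteractionEtaPositive

open Finset Literature.Probability.LatticeModels

/-- **The window of the thermal-rates certificate (`γ' ≥ 2β` in bound form on `ℤ³`).** If for `t ∈ (0, t₀]`
the spontaneous magnetisation obeys `m*(β_c(3)+t) ≤ C₁ t^{b̂}` (`b̂ > 0`) and the truncated plus two-point sums
obey `Σ_{y∈Λ} ⟨σ₀;σ_y⟩⁺_{β_c+t} ≤ C₂ t^{-g}` for every finite `Λ` (`g ≥ 0`), then `2 b̂ ≤ g`: the isotherm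
rate `b̂/(b̂+g)` produced by `isotherm_of_thermalRates` is at most `1/3` (`isothermGain_exponent_le_third`).
Registered stub of stmt-CriticalPhenomena-2600 (verbatim one-line header). -/
theorem thermalRates_window : ∀ bh g C₁ C₂ t₀ : ℝ, 0 < t₀ → 0 < bh → 0 ≤ g → (∀ t : ℝ, 0 < t → t ≤ t₀ → Literature.Probability.LatticeModels.spontaneousMagnetization 3 (Literature.Probability.LatticeModels.criticalBeta 3 + t) ≤ C₁ * t ^ bh) → (∀ t : ℝ, 0 < t → t ≤ t₀ → ∀ Λ : Finset (Literature.Probability.LatticeModels.Site 3), ∑ y ∈ Λ, (Literature.Probability.LatticeModels.plusExpect 3 (Literature.Probability.LatticeModels.criticalBeta 3 + t) 0 (fun σ => Literature.Probability.LatticeModels.spinAt 0 σ * Literature.Probability.LatticeModels.spinAt y σ) - Literature.Probability.LatticeModels.plusExpect 3 (Literature.Probability.LatticeModels.criticalBeta 3 + t) 0 (Literature.Probability.LatticeModels.spinAt 0) * Literature.Probability.LatticeModels.plusExpect 3 (Literature.Probability.LatticeModels.criticalBeta 3 + t) 0 (Literature.Probability.LatticeModels.spinAt y)) ≤ C₂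 * t ^ (-g)) → 2 * bh ≤ g := by
  intro bh g C₁ C₂ t₀ ht₀ hbh hg hM hχ
  obtain ⟨A, h₀, hh₀, H⟩ := isotherm_of_thermalRates ht₀ hbh hg hM hχ
  have hs : 0 < bh + g := by linarith
  have hb : 0 < bh / (bh + g) := div_pos hbh hs
  have hthird := isothermGain_exponent_le_third (bh / (bh + g)) A h₀ hb hh₀ H
  rw [div_le_iff₀ hs] at hthird
  linarith

end Summit.CriticalPhenomena.Ising3DConformalLimit.AnomalousForcesInteractionEtaPositive
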